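import Mathlib
import HarnessLib
import Summits.ValiantsHypothesis.ValiantsHypothesis.Theorems.EquivariantDialLayersCuts
import Summits.ValiantsHypothesis.ValiantsHypothesis.Theorems.EquivariantDialBlockGaugeAssembly

/-!
# Equivariant dial, layered face — coprime cuts of `per_m` are quadratic (K-characters)

Support for the cell `A = EqHardBiPerm` (item `stmt-ValiantsHypothesis-23702`, draft route `SymmetryDial`)
via its layered leaf `R^lay = IdealWidthSuperpoly` (`EquivariantDialLayers`: `idealWidth (biPermSubst m)
per_m d` = least number of degree-`d` forms with window-stable span whose ideal contains `per_m`;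
window = `𝔖_m × 𝔖_m`).  HONEST FRAMING: `VP ≠ VNP` is NOT proved here, nor `A`, nor `R^lay`, nor any
super-polynomial bound — SIZE-FREE rungs ON the leaf at EVERY degree `d`, every `m`, elementary
(characters of the abelian subgroup `K = ⟨(c,1),(1,c)⟩ ≅ (ℤ/m)²` of the window, `c` = cyclic shift),
new only as kernel theorems here; NO definitions, 0 stubs, 0 named facts, 0 summit-currency.
* §1 Test points and projectors.  The rank-one point `x_{a,b} = (a^i b^j)_{ij}` (`a, b ∈ μ_m`) is a JOINT
  EIGENVECTOR of `K`: `x_{a,b} ∘ (shift u, shift v) = a^u b^v • x_{a,b}` (`powPoint_comp_shift`), and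
  `per_m (x_{a,b}) = m!·∏ a^i·∏ b^j ≠ 0`.  For a degree-`d` form `p` the `K`-projector
  `Q = ∑_{u,v} ((a^u b^v)^d)⁻¹ • rename (shift u × shift v) p` evaluates at `x_{a',b'}` to
  `(∑_u ρ₁^u)(∑_v ρ₂^v)·p(x_{a',b'})`, `ρ₁ = a'^d/a^d`, `ρ₂ = b'^d/b^d` (`eval_projector`): character
  orthogonality makes the evaluation matrix DIAGONAL on any `A × B ⊆ μ_m²` on which `z ↦ z^d` is injective.
* §2 `card_mul_card_le_of_hasIdealWidthLE`: such `A, B` force `|A|·|B| ≤ r` for every window-stable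
  degree-`d` cut of `per_m` by `r` forms (the projectors of cut forms not vanishing at the test points are
  linearly independent in the span); with `A = B = {ζ^k : k < m / gcd(m,d)}`:
  **`(m / gcd(m,d))² ≤ r`** (`sq_div_gcd_le_of_hasIdealWidthLE`), so **`m² ≤ r` whenever `gcd(m,d) = 1`**
  (`sq_le_of_hasIdealWidthLE_of_coprime`: every cut of `per_p`, `p` prime; `d = 1`; `d = m - 1`).
* §3 The last proper column exactly: the `m²` first partials `∂_{ij} per_m` are a window-stable cut in
  degree `m - 1` (Euler's identity), so **`idealWidth (biPermSubst m) per_m (m - 1) = m²`** (`1 ≤ m`).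
METHOD CEILING m² (rank-one points carry ≤ m² K-characters ⇒ this method calibrates the leaf's FLOOR and
can never witness R^lay); the blind spot gcd(m,d) > 1 (e.g. (4,2): theorem 4 vs instrument 18 ≤ r ≤ 24) is
exactly the set of character-degenerate cuts — both recorded here, not hidden.
Reused by import, not restated: `permanent_vecMulVec`, `eval_perPoly`, `eval_smul_of_isHomogeneous`,
`linSubst_permMatrix`, `permMatrix_mem_permSubst`, `exists_prodCongr_of_mem_biPermSubst`, `idealWidth_le`,
`perPoly_isHomogeneous`; Mathlib: `IsHomogeneous.sum_X_mul_pderiv`, `IsHomogeneous.pderiv`, `pderiv_rename`,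
`IsOfFinOrder.pow_eq_pow_iff_modEq`, `Nat.ModEq.cancel_right_div_gcd`.
-/

set_option linter.dupNamespace false

namespace Summit.ValiantsHypothesis.ValiantsHypothesis.Theorems.EquivariantDialLayersCharacters

open MvPolynomial Matrix Literature.Computability.AlgebraicComplexity
open Summit.ValiantsHypothesis.ValiantsHypothesis.Theorems.EquivariantDialNode
open Summit.ValiantsHypothesis.ValiantsHypothesis.Theorems.EquivariantDialLayers
open Summit.ValiantsHypothesis.ValiantsHypothesis.Theorems.EquivariantDialLayersToy
open Summit.ValiantsHypothesis.ValiantsHypothesis.Theorems.EquivariantDialLayersCuts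

noncomputable section

/-! ## §1 Test points, shifts and projectors -/

/-- A member of an ideal that does not vanish at `x` leaves some generator non-zero at `x`. -/
theorem exists_eval_ne_zero_of_mem_idealSpan {σ : Type*} {x : σ → ℂ} {S : Set (MvPolynomial σ ℂ)}
    {q : MvPolynomial σ ℂ} (hq : q ∈ Ideal.span S) (hx : eval x q ≠ 0) : ∃ p ∈ S, eval x p ≠ 0 := by
  by_contra h
  push Not at h
  exact hx (RingHom.mem_ker.mp
    ((Ideal.span_le (I := RingHom.ker (eval x))).mpr (fun p hp => RingHom.mem_ker.mpr (h p hp)) hq))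

/-- A window-stable cut is stable under the relabelling `x_{ij} ↦ x_{σ i, τ j}` of its forms. -/
theorem rename_prodCongr_mem_span {m : ℕ} {s : Finset (MvPolynomial (Fin m × Fin m) ℂ)}
    (hstab : ∀ γ ∈ biPermSubst m, ∀ p ∈ s, linSubst (Fin m × Fin m) ℂ
      (γ : Matrix (Fin m × Fin m) (Fin m × Fin m) ℂ) p ∈
        Submodule.span ℂ (s : Set (MvPolynomial (Fin m × Fin m) ℂ)))
    (σ τ : Equiv.Perm (Fin m)) {p : MvPolynomial (Fin m × Fin m) ℂ} (hp : p ∈ s) :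
    rename (Equiv.prodCongr σ τ) p ∈ Submodule.span ℂ (s : Set (MvPolynomial (Fin m × Fin m) ℂ)) := by
  obtain ⟨γ, -, hγ⟩ :=
    permMatrix_mem_permSubst (k := ℂ) (σ := Fin m × Fin m) (Equiv.prodCongr σ.symm τ.symm)
  have h1 := hstab γ (Subgroup.subset_closure ⟨σ.symm, τ.symm, hγ⟩) p hp
  rw [hγ, linSubst_permMatrix] at h1
  simpa only [Equiv.prodCongr_symm, Equiv.symm_symm] using h1

/-- `per_m` at the rank-one test point `x_{a,b} = (a^i b^j)_{ij}`: `m! · ∏ a^i · ∏ b^j`. -/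
theorem eval_powPoint_perPoly (m : ℕ) (a b : ℂ) :
    eval (fun ij : Fin m × Fin m => a ^ (ij.1 : ℕ) * b ^ (ij.2 : ℕ)) (perPoly (Fin m) ℂ) =
      (m.factorial : ℂ) * ((∏ i : Fin m, a ^ (i : ℕ)) * ∏ j : Fin m, b ^ (j : ℕ)) := by
  rw [eval_perPoly]
  convert permanent_vecMulVec (fun i : Fin m => a ^ (i : ℕ)) (fun j : Fin m => b ^ (j : ℕ)) using 2
  · ext i j
    simp [vecMulVec_apply]
  · rw [Fintype.card_fin]

/-- `per_m (x_{a,b}) ≠ 0` for `a, b ≠ 0`. -/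
theorem eval_powPoint_perPoly_ne_zero (m : ℕ) {a b : ℂ} (ha : a ≠ 0) (hb : b ≠ 0) :
    eval (fun ij : Fin m × Fin m => a ^ (ij.1 : ℕ) * b ^ (ij.2 : ℕ)) (perPoly (Fin m) ℂ) ≠ 0 := by
  rw [eval_powPoint_perPoly]
  exact mul_ne_zero (Nat.cast_ne_zero.mpr (Nat.factorial_ne_zero m))
    (mul_ne_zero (Finset.prod_ne_zero_iff.mpr fun i _ => pow_ne_zero _ ha)
      (Finset.prod_ne_zero_iff.mpr fun j _ => pow_ne_zero _ hb))

/-- A root of unity is non-zero. -/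
theorem ne_zero_of_pow_eq_one' {m : ℕ} [NeZero m] {c : ℂ} (hc : c ^ m = 1) : c ≠ 0 := by
  rintro rfl
  rw [zero_pow (NeZero.ne m)] at hc
  exact zero_ne_one hc

/-- JOINT EIGENVECTOR.  Shifting rows by `u` and columns by `v` rescales the test point `x_{a,b}`
(`a^m = b^m = 1`) by the character value `a^u b^v`. -/
theorem powPoint_comp_shift {m : ℕ} [NeZero m] {a b : ℂ} (ha : a ^ m = 1) (hb : b ^ m = 1)
    (u v : Fin m) :
    (fun ij : Fin m × Fin m => a ^ (ij.1 : ℕ) * b ^ (ij.2 : ℕ)) ∘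
        (Equiv.prodCongr (Equiv.addRight u) (Equiv.addRight v)) =
      (a ^ (u : ℕ) * b ^ (v : ℕ)) • fun ij : Fin m × Fin m => a ^ (ij.1 : ℕ) * b ^ (ij.2 : ℕ) := by
  funext ij
  obtain ⟨i, j⟩ := ij
  simp only [Function.comp_apply, Equiv.prodCongr_apply, Prod.map_apply, Equiv.coe_addRight,
    Pi.smul_apply, smul_eq_mul, Fin.val_add]
  rw [← pow_eq_pow_mod ((i : ℕ) + (u : ℕ)) ha, ← pow_eq_pow_mod ((j : ℕ) + (v : ℕ)) hb,
    pow_add, pow_add]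
  ring

/-- Hence a degree-`d` form picks up the factor `(a^u b^v)^d` under the shift, at `x_{a,b}`. -/
theorem eval_rename_shift_powPoint {m d : ℕ} [NeZero m] {a b : ℂ} (ha : a ^ m = 1) (hb : b ^ m = 1)
    {p : MvPolynomial (Fin m × Fin m) ℂ} (hp : p.IsHomogeneous d) (u v : Fin m) :
    eval (fun ij : Fin m × Fin m => a ^ (ij.1 : ℕ) * b ^ (ij.2 : ℕ))
        (rename (Equiv.prodCongr (Equiv.addRight u) (Equiv.addRight v)) p) =
      (a ^ (u : ℕ) * b ^ (v : ℕ)) ^ d *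
        eval (fun ij : Fin m × Fin m => a ^ (ij.1 : ℕ) * b ^ (ij.2 : ℕ)) p := by
  rw [eval_rename, powPoint_comp_shift ha hb, eval_smul_of_isHomogeneous hp]

/-- CHARACTER ORTHOGONALITY, trivial character: `∑_{u < m} 1 = m`. -/
theorem sum_one_pow_fin (m : ℕ) : ∑ u : Fin m, (1 : ℂ) ^ (u : ℕ) = m := by
  simp

/-- CHARACTER ORTHOGONALITY, non-trivial character: `∑_{u < m} ρ^u = 0` for `ρ^m = 1`, `ρ ≠ 1`. -/
theorem sum_pow_fin_eq_zero {m : ℕ} {ρ : ℂ} (hρ : ρ ^ m = 1) (h1 : ρ ≠ 1) :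
    ∑ u : Fin m, ρ ^ (u : ℕ) = 0 := by
  rw [Fin.sum_univ_eq_sum_range (fun k => ρ ^ k) m, geom_sum_eq h1, hρ, sub_self, zero_div]

/-- The ratio character `a'^d / a^d` is again an `m`-th root of unity. -/
theorem ratio_pow_eq_one {m d : ℕ} {a a' : ℂ} (ha : a ^ m = 1) (ha' : a' ^ m = 1) :
    (a' ^ d * (a ^ d)⁻¹) ^ m = 1 := by
  rw [mul_pow, inv_pow, ← pow_mul, ← pow_mul, mul_comm d m, pow_mul, pow_mul, ha', ha, one_pow,
    inv_one, mul_one]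

/-- PROJECTOR EVALUATION.  The `K`-projector of a degree-`d` form `p` built at `(a, b)`, evaluated at
the test point of `(a', b')`: `(∑_u ρ₁^u)(∑_v ρ₂^v) · p(x_{a',b'})` with `ρ₁ = a'^d/a^d`, `ρ₂ = b'^d/b^d`
(a formal identity: only `a'^m = b'^m = 1` is used, through the eigen-relation). -/
theorem eval_projector {m d : ℕ} [NeZero m] {a b a' b' : ℂ} (ha' : a' ^ m = 1) (hb' : b' ^ m = 1)
    {p : MvPolynomial (Fin m × Fin m) ℂ} (hp : p.IsHomogeneous d) :
    eval (fun ij : Fin m × Fin m => a' ^ (ij.1 : ℕ) * b' ^ (ij.2 : ℕ))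
        (∑ u : Fin m, ∑ v : Fin m, ((a ^ (u : ℕ) * b ^ (v : ℕ)) ^ d)⁻¹ •
          rename (Equiv.prodCongr (Equiv.addRight u) (Equiv.addRight v)) p) =
      ((∑ u : Fin m, (a' ^ d * (a ^ d)⁻¹) ^ (u : ℕ)) * ∑ v : Fin m, (b' ^ d * (b ^ d)⁻¹) ^ (v : ℕ)) *
        eval (fun ij : Fin m × Fin m => a' ^ (ij.1 : ℕ) * b' ^ (ij.2 : ℕ)) p := by
  simp only [map_sum, smul_eval, eval_rename_shift_powPoint ha' hb' hp]
  rw [Finset.sum_mul_sum, Finset.sum_mul]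
  refine Finset.sum_congr rfl fun u _ => ?_
  rw [Finset.sum_mul]
  refine Finset.sum_congr rfl fun v _ => ?_
  ring

/-! ## §2 The character count: `|A|·|B| ≤ r`, `(m / gcd(m,d))² ≤ r`, coprime cuts `≥ m²` -/

/-- **CHARACTER COUNT.**  If `A, B ⊆ μ_m(ℂ)` and `z ↦ z ^ d` is injective on `A` and on `B`, every
window-stable degree-`d` cut of `per_m` has at least `|A|·|B|` forms: the projectors of cut forms not
vanishing at the test points `x_{a,b}` have a diagonal evaluation matrix, hence are linearly independent
in the span of the cut. -/
theorem card_mul_card_le_of_hasIdealWidthLE {m d r : ℕ} [NeZero m] (A B : Finset ℂ)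
    (hA : ∀ a ∈ A, a ^ m = 1) (hB : ∀ b ∈ B, b ^ m = 1)
    (hAd : Set.InjOn (fun a : ℂ => a ^ d) A) (hBd : Set.InjOn (fun b : ℂ => b ^ d) B)
    (h : HasIdealWidthLE (biPermSubst m) (perPoly (Fin m) ℂ) d r) : A.card * B.card ≤ r := by
  classical
  obtain ⟨s, hcard, hhom, hstab, hmem⟩ := h
  -- a cut form not vanishing at each test point
  have hx : ∀ i : ↥A × ↥B, ∃ p ∈ s,
      eval (fun ij : Fin m × Fin m => (i.1 : ℂ) ^ (ij.1 : ℕ) * (i.2 : ℂ) ^ (ij.2 : ℕ)) p ≠ 0 :=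
    fun i => exists_eval_ne_zero_of_mem_idealSpan hmem (eval_powPoint_perPoly_ne_zero m
      (ne_zero_of_pow_eq_one' (hA _ i.1.2)) (ne_zero_of_pow_eq_one' (hB _ i.2.2)))
  choose p hps hpx using hx
  -- the projectors lie in the span of the cut
  let W : Submodule ℂ (MvPolynomial (Fin m × Fin m) ℂ) :=
    Submodule.span ℂ (s : Set (MvPolynomial (Fin m × Fin m) ℂ))
  have hQ : ∀ i : ↥A × ↥B, (∑ u : Fin m, ∑ v : Fin m,
      (((i.1 : ℂ) ^ (u : ℕ) * (i.2 : ℂ) ^ (v : ℕ)) ^ d)⁻¹ •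
        rename (Equiv.prodCongr (Equiv.addRight u) (Equiv.addRight v)) (p i)) ∈ W := fun i =>
    Submodule.sum_mem _ fun u _ => Submodule.sum_mem _ fun v _ =>
      Submodule.smul_mem _ _ (rename_prodCongr_mem_span hstab _ _ (hps i))
  let Q : ↥A × ↥B → W := fun i => ⟨_, hQ i⟩
  -- the evaluation matrix `(Q i)(x_j)` is diagonal with non-zero diagonal
  have hQe : ∀ i j : ↥A × ↥B,
      eval (fun ij : Fin m × Fin m => (j.1 : ℂ) ^ (ij.1 : ℕ) * (j.2 : ℂ) ^ (ij.2 : ℕ))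
          (Q i : MvPolynomial (Fin m × Fin m) ℂ) =
        ((∑ u : Fin m, ((j.1 : ℂ) ^ d * ((i.1 : ℂ) ^ d)⁻¹) ^ (u : ℕ)) *
            ∑ v : Fin m, ((j.2 : ℂ) ^ d * ((i.2 : ℂ) ^ d)⁻¹) ^ (v : ℕ)) *
          eval (fun ij : Fin m × Fin m => (j.1 : ℂ) ^ (ij.1 : ℕ) * (j.2 : ℂ) ^ (ij.2 : ℕ)) (p i) :=
    fun i j => eval_projector (hA _ j.1.2) (hB _ j.2.2) (hhom _ (hps i))
  have hdiag : ∀ i : ↥A × ↥B,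
      eval (fun ij : Fin m × Fin m => (i.1 : ℂ) ^ (ij.1 : ℕ) * (i.2 : ℂ) ^ (ij.2 : ℕ))
        (Q i : MvPolynomial (Fin m × Fin m) ℂ) ≠ 0 := by
    intro i
    rw [hQe, mul_inv_cancel₀ (pow_ne_zero _ (ne_zero_of_pow_eq_one' (hA _ i.1.2))),
      mul_inv_cancel₀ (pow_ne_zero _ (ne_zero_of_pow_eq_one' (hB _ i.2.2))), sum_one_pow_fin]
    exact mul_ne_zero (mul_ne_zero (Nat.cast_ne_zero.mpr (NeZero.ne m))
      (Nat.cast_ne_zero.mpr (NeZero.ne m))) (hpx i)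
  have hoff : ∀ i j : ↥A × ↥B, i ≠ j →
      eval (fun ij : Fin m × Fin m => (j.1 : ℂ) ^ (ij.1 : ℕ) * (j.2 : ℂ) ^ (ij.2 : ℕ))
        (Q i : MvPolynomial (Fin m × Fin m) ℂ) = 0 := by
    intro i j hij
    rw [hQe]
    by_cases h1 : i.1 = j.1
    · have h2 : (i.2 : ℂ) ≠ (j.2 : ℂ) := fun h2 =>
        hij (Prod.ext h1 (Subtype.ext h2))
      have hρ : (j.2 : ℂ) ^ d * ((i.2 : ℂ) ^ d)⁻¹ ≠ 1 := fun hρ =>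
        h2 (hBd i.2.2 j.2.2 ((mul_inv_eq_one₀ (pow_ne_zero _
          (ne_zero_of_pow_eq_one' (hB _ i.2.2)))).mp hρ).symm)
      rw [sum_pow_fin_eq_zero (ratio_pow_eq_one (hB _ i.2.2) (hB _ j.2.2)) hρ, mul_zero, zero_mul]
    · have h1' : (i.1 : ℂ) ≠ (j.1 : ℂ) := fun h => h1 (Subtype.ext h)
      have hρ : (j.1 : ℂ) ^ d * ((i.1 : ℂ) ^ d)⁻¹ ≠ 1 := fun hρ =>
        h1' (hAd i.1.2 j.1.2 ((mul_inv_eq_one₀ (pow_ne_zero _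
          (ne_zero_of_pow_eq_one' (hA _ i.1.2)))).mp hρ).symm)
      rw [sum_pow_fin_eq_zero (ratio_pow_eq_one (hA _ i.1.2) (hA _ j.1.2)) hρ, zero_mul, zero_mul]
  -- hence the projectors are linearly independent in `W`
  have hli : LinearIndependent ℂ Q := by
    rw [Fintype.linearIndependent_iff]
    intro g hg j
    have h1 := congrArg (fun q : W =>
      eval (fun ij : Fin m × Fin m => (j.1 : ℂ) ^ (ij.1 : ℕ) * (j.2 : ℂ) ^ (ij.2 : ℕ))
        (q : MvPolynomial (Fin m × Fin m) ℂ)) hg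
    simp only [Submodule.coe_sum, Submodule.coe_smul, map_sum, smul_eval, Submodule.coe_zero,
      map_zero] at h1
    rw [Finset.sum_eq_single j (fun i _ hij => by rw [hoff i j hij, mul_zero])
      (fun hj => absurd (Finset.mem_univ j) hj)] at h1
    exact (mul_eq_zero.mp h1).resolve_right (hdiag j)
  -- count
  calc A.card * B.card = Fintype.card (↥A × ↥B) := by simp
    _ ≤ Module.finrank ℂ W := hli.fintype_card_le_finrank
    _ ≤ s.card := finrank_span_finset_le_card s
    _ ≤ r := hcard

/-- **Every window-stable cut of `per_m` in degree `d` has at least `(m / gcd(m,d))²` forms.**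
(`A = B = {ζ^k : k < m / gcd(m,d)}`, `ζ` a primitive `m`-th root of unity: `k ↦ ζ^{kd}` is injective
there.) -/
theorem sq_div_gcd_le_of_hasIdealWidthLE {m d r : ℕ} (hm : 0 < m)
    (h : HasIdealWidthLE (biPermSubst m) (perPoly (Fin m) ℂ) d r) : (m / Nat.gcd m d) ^ 2 ≤ r := by
  classical
  haveI : NeZero m := ⟨hm.ne'⟩
  obtain ⟨ζ, hζ⟩ : ∃ ζ : ℂ, IsPrimitiveRoot ζ m := ⟨_, Complex.isPrimitiveRoot_exp m hm.ne'⟩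
  have hfin : IsOfFinOrder ζ := isOfFinOrder_iff_pow_eq_one.mpr ⟨m, hm, hζ.pow_eq_one⟩
  have hnm : m / Nat.gcd m d ≤ m := Nat.div_le_self m _
  let A : Finset ℂ := (Finset.range (m / Nat.gcd m d)).image fun k => ζ ^ k
  have hAcard : A.card = m / Nat.gcd m d := by
    rw [Finset.card_image_of_injOn, Finset.card_range]
    intro k hk k' hk' hkk'
    exact hζ.pow_inj (lt_of_lt_of_le (Finset.mem_range.mp (Finset.mem_coe.mp hk)) hnm)
      (lt_of_lt_of_le (Finset.mem_range.mp (Finset.mem_coe.mp hk')) hnm) hkk'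
  have hAm : ∀ a ∈ A, a ^ m = 1 := by
    intro a ha
    obtain ⟨k, -, rfl⟩ := Finset.mem_image.mp ha
    rw [← pow_mul, mul_comm, pow_mul, hζ.pow_eq_one, one_pow]
  have hAd : Set.InjOn (fun a : ℂ => a ^ d) A := by
    intro a ha a' ha' haa'
    obtain ⟨k, hk, rfl⟩ := Finset.mem_image.mp (Finset.mem_coe.mp ha)
    obtain ⟨k', hk', rfl⟩ := Finset.mem_image.mp (Finset.mem_coe.mp ha')
    have hkk : k * d ≡ k' * d [MOD m] := by
      have h1 : ζ ^ (k * d) = ζ ^ (k' * d) := by simpa only [← pow_mul] using haa'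
      rwa [hfin.pow_eq_pow_iff_modEq, ← hζ.eq_orderOf] at h1
    rw [Nat.ModEq.eq_of_lt_of_lt (Nat.ModEq.cancel_right_div_gcd hm hkk) (Finset.mem_range.mp hk)
      (Finset.mem_range.mp hk')]
  have := card_mul_card_le_of_hasIdealWidthLE A A hAm hAm hAd hAd h
  rwa [hAcard, ← sq] at this

/-- **COPRIME CUTS ARE QUADRATIC**: `gcd(m,d) = 1 ⇒ r ≥ m²` (every cut of `per_p`, `p` prime; `d = 1`
and `d = m - 1` for every `m`). -/
theorem sq_le_of_hasIdealWidthLE_of_coprime {m d r : ℕ} (hm : 0 < m) (hcop : Nat.Coprime m d)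
    (h : HasIdealWidthLE (biPermSubst m) (perPoly (Fin m) ℂ) d r) : m ^ 2 ≤ r := by
  have := sq_div_gcd_le_of_hasIdealWidthLE hm h
  rwa [Nat.Coprime.gcd_eq_one hcop, Nat.div_one] at this

/-- The same floor on the leaf's `idealWidth`, wherever a window-stable degree-`d` cut exists at all. -/
theorem sq_div_gcd_le_idealWidth {m d : ℕ} (hm : 0 < m)
    (hne : ∃ r, HasIdealWidthLE (biPermSubst m) (perPoly (Fin m) ℂ) d r) :
    (m / Nat.gcd m d) ^ 2 ≤ idealWidth (biPermSubst m) (perPoly (Fin m) ℂ) d := by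
  obtain ⟨r, hr⟩ := hne
  unfold idealWidth
  exact le_csInf ⟨r, hr⟩ fun r' hr' => sq_div_gcd_le_of_hasIdealWidthLE hm hr'

/-! ## §3 The last proper column: `idealWidth (biPermSubst m) per_m (m - 1) = m²` -/

/-- `per_m` is invariant under INDEPENDENT relabelling of rows and columns (`x_{ij} ↦ x_{σ i, τ j}`). -/
theorem rename_prodCongr_perPoly {m : ℕ} (σ τ : Equiv.Perm (Fin m)) :
    rename (Equiv.prodCongr σ τ) (perPoly (Fin m) ℂ) = perPoly (Fin m) ℂ := by
  simp only [perPoly, Matrix.permanent, map_sum, map_prod, Matrix.mvPolynomialX_apply, rename_X,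
    Equiv.prodCongr_apply, Prod.map_apply]
  refine Fintype.sum_equiv ((Equiv.mulRight τ⁻¹).trans (Equiv.mulLeft σ)) _ _ fun π => ?_
  refine Fintype.prod_equiv τ _ _ fun i => ?_
  simp [Equiv.Perm.mul_apply]

/-- Relabelling a first partial: `rename (σ × τ) (∂_{ij} per_m) = ∂_{(σ i, τ j)} per_m`. -/
theorem rename_prodCongr_pderiv_perPoly {m : ℕ} (σ τ : Equiv.Perm (Fin m)) (ij : Fin m × Fin m) :
    rename (Equiv.prodCongr σ τ) (pderiv ij (perPoly (Fin m) ℂ)) =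
      pderiv (Equiv.prodCongr σ τ ij) (perPoly (Fin m) ℂ) := by
  rw [← pderiv_rename (Equiv.prodCongr σ τ).injective, rename_prodCongr_perPoly]

/-- EULER: `per_m ∈ ⟨∂_{ij} per_m : i, j⟩` for `1 ≤ m` (`∑ x_{ij} ∂_{ij} per_m = m · per_m`). -/
theorem perPoly_mem_idealSpan_pderiv {m : ℕ} (hm : 1 ≤ m) :
    perPoly (Fin m) ℂ ∈
      Ideal.span (Set.range fun ij : Fin m × Fin m => pderiv ij (perPoly (Fin m) ℂ)) := by
  have heuler := (perPoly_isHomogeneous (n := Fin m) (k := ℂ)).sum_X_mul_pderiv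
  rw [Fintype.card_fin] at heuler
  have hmem : (m : MvPolynomial (Fin m × Fin m) ℂ) * perPoly (Fin m) ℂ ∈
      Ideal.span (Set.range fun ij : Fin m × Fin m => pderiv ij (perPoly (Fin m) ℂ)) := by
    rw [← nsmul_eq_mul, ← heuler]
    exact Ideal.sum_mem _ fun ij _ => Ideal.mul_mem_left _ _ (Ideal.subset_span ⟨ij, rfl⟩)
  have h2 := Ideal.mul_mem_left _ (C ((m : ℂ)⁻¹)) hmem
  rwa [← mul_assoc, ← map_natCast (C : ℂ →+* MvPolynomial (Fin m × Fin m) ℂ) m, ← map_mul,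
    inv_mul_cancel₀ (Nat.cast_ne_zero.mpr (by omega : m ≠ 0)), map_one, one_mul] at h2

/-- UPPER BOUND at `d = m - 1`: the `m²` first partials `∂_{ij} per_m` (the `(m-1) × (m-1)`
subpermanents) are a window-stable degree-`(m-1)` cut of `per_m`. -/
theorem hasIdealWidthLE_perPoly_sub_one {m : ℕ} (hm : 1 ≤ m) :
    HasIdealWidthLE (biPermSubst m) (perPoly (Fin m) ℂ) (m - 1) (m ^ 2) := by
  classical
  refine ⟨Finset.univ.image fun ij : Fin m × Fin m => pderiv ij (perPoly (Fin m) ℂ), ?_, ?_, ?_, ?_⟩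
  · exact Finset.card_image_le.trans_eq (by simp [sq])
  · intro p hp
    obtain ⟨ij, -, rfl⟩ := Finset.mem_image.mp hp
    have := (perPoly_isHomogeneous (n := Fin m) (k := ℂ)).pderiv (i := ij)
    rwa [Fintype.card_fin] at this
  · intro γ hγ p hp
    obtain ⟨ij, -, rfl⟩ := Finset.mem_image.mp hp
    obtain ⟨σ, τ, hγe⟩ := exists_prodCongr_of_mem_biPermSubst hγ
    rw [hγe, linSubst_permMatrix, Equiv.prodCongr_symm, rename_prodCongr_pderiv_perPoly]
    exact Submodule.subset_span (Finset.mem_coe.mpr (Finset.mem_image.mpr ⟨_, Finset.mem_univ _, rfl⟩))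
  · refine Ideal.span_mono ?_ (perPoly_mem_idealSpan_pderiv hm)
    rintro _ ⟨ij, rfl⟩
    exact Finset.mem_coe.mpr (Finset.mem_image.mpr ⟨ij, Finset.mem_univ _, rfl⟩)

/-- **`idealWidth (biPermSubst m) per_m (m - 1) = m²`** (`1 ≤ m`): the last proper column of the leaf,
exactly — upper bound the first partials, lower bound the coprime cut `gcd(m, m-1) = 1`. -/
theorem idealWidth_perPoly_sub_one_eq {m : ℕ} (hm : 1 ≤ m) :
    idealWidth (biPermSubst m) (perPoly (Fin m) ℂ) (m - 1) = m ^ 2 := by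
  refine le_antisymm (idealWidth_le (hasIdealWidthLE_perPoly_sub_one hm)) ?_
  have hcop : Nat.Coprime m (m - 1) := by
    have h := Nat.dvd_sub (Nat.gcd_dvd_left m (m - 1)) (Nat.gcd_dvd_right m (m - 1))
    rw [show m - (m - 1) = 1 by omega] at h
    exact Nat.eq_one_of_dvd_one h
  unfold idealWidth
  exact le_csInf ⟨m ^ 2, hasIdealWidthLE_perPoly_sub_one hm⟩
    fun r hr => sq_le_of_hasIdealWidthLE_of_coprime hm hcop hr

end

end Summit.ValiantsHypothesis.ValiantsHypothesis.Theorems.EquivariantDialLayersCharacters
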